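import Summits.QuantumFields.BalabanUV.Beta.GAN24.AliasDecimate
import Summits.QuantumFields.BalabanUV.Beta.GAN24.FibreContinuity

/-!
# `BalabanUV.Beta.GAN24.MinimiserColumnDecimate` — binder row G-an2-4 / (CONV-C), S-slot road «S3», register tag «N1-CAUCHY-FRAME*»:
# THE PACKED RESOLVENT OF BLOCKING `N`, ENTRY BY ENTRY, AS A LATTICE KERNEL OVER THE MOMENTUM OF THE COARSER BLOCKING `N·L` —
# the frame in which the two-level comparison «(N1-Cauchy)» of `SKELETON-S3.md` v1.0 §13.2 (a) is a symbol difference on ONE torus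

NOT IN PRINT; OUR PROOF ATTEMPT (of the road; THIS file is [folklore] bookkeeping: gan24-p1's `CombesThomasFibre.KInv_eq_re_latticeKernel`
(every block of an2's `KInv N` is `Re latticeKernel (fibInv N i j) (block-label displacement)`) composed with this lineage's decimation
identity `AliasDecimate.latticeKernel_decimate`; its two inputs — global `2π`-periodicity of the inverse-fibre entries
(`FibreInverseDecay.cphase_periodic` on `trigPolySymbol`) and their continuity at EVERY real momentum (the typer's road-P1 row Y09c
`GAN24/FibreContinuity.continuous_fibInv_ofRealVec`, BY NAME) — the first proved here, the second imported; no estimate, no cited fact, no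
`def … : Prop`, no wall binder).  G-an2-4 formalisation swarm, leaf prover 17 (unit `b2b-balaban-gan24-formalise-leaf-17`,
gen 11; cell journal INTENT «N1-CAUCHY-FRAME*»), complementary to leaf-16's located input «(N1-Cauchy)» (the ESTIMATE of the symbol
difference is theirs; the FRAME is this file).  HONEST FRAMING (cell contract, verbatim): «discharging `BetaPertH` makes Bałaban's UV
stability UNCONDITIONAL — a real constructive-QFT result; it is NOT the continuum limit and NOT the Clay problem.»  HONEST DEPENDENCY
(verbatim): «continuum YM on T⁴ ⇐ BetaPertH ∧ nine spine estimates (0/9 proved); BetaPertH ⇐ (D1) ∧ (D4) ∧ CAP+tail; G-an2-4 gates asym,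
D1 and NE2/3/4.»  NOT summit progress; nothing of (CONV-C)'s S-slot («E3Shape» ∕ «E3SupRate», OPEN, not in print) is discharged here.

WHERE IT SITS (context only, asserted nowhere below).  The RATE table of `SKELETON-S3.md` v1.0 §13 pairs pieces of consecutive members BY
DEPTH; their difference is controlled by «(N1-Cauchy)»: the one-step convergence of the normalised minimiser column `H̃_{N·Lc}` against
`H̃_N` at the same fine offset.  `wH_N` is a lattice kernel over the level-`N` momentum (`CombesThomasFibre.wH_eq_re_latticeKernel`),
`wH_{N·Lc}` over the level-`N·Lc` momentum; this file reads the FORMER over the LATTER's momentum (`wH_eq_re_latticeKernel_decimate'`: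
the `N`-block label `quo N z = Lc • quo (N·Lc) z + boff N Lc z`, offset `boff ∈ {0,…,Lc−1}^{d+1}`), so the difference of the two columns
is `Re latticeKernel` of ONE symbol difference `fibInv (N·Lc) … − (units) · aliasSym Lc (boff z) (fibInv N …)` at the common coarse point
— whose strip bound (leaf-16's alias-by-alias formulas `GAN24/FineReadoutColumn`∕`FineReadoutAlias` at the two levels, the alias indices
nesting by E8 `AliasNest`: `(ℤ∕(N·Lc))^{d+1} ≃ (ℤ∕Lc)^{d+1} × (ℤ∕N)^{d+1}`) then gives decay AND smallness by ONE Paley–Wiener step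
(`B4ContourShift.latticeKernel_decay`).  The same for the three other blocks and hence for every K-slot reading.  This is road P1's L11
pattern (`FibreRate`: two levels compared through `AliasReindex`) with the re-indexing replaced by a kernel identity.

## What is proved ([folklore], `0 sorry`; generic `d`, any blockings `N, L ≥ 1`)
* §1 `trigPolySymbol_periodic`, **`fibInv_periodic`** (global coordinatewise `2π`-periodicity of every inverse-fibre entry); continuity at
  every real momentum is `FibreContinuity.continuous_fibInv_ofRealVec` BY NAME.
* §2 `boff N L z := (quo N z) mod L`, **`quo_eq_zsmul_quo_mul_add`**
  (`quo N z = L • quo (N·L) z + boff N L z`), `boff_nonneg`, `boff_lt`.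
* §3 **`wH_eq_re_latticeKernel_decimate`** (any decomposition `quo N z = L • Z + r`) and its canonical instance
  **`wH_eq_re_latticeKernel_decimate'`**; `wΦ_eq_re_latticeKernel_decimate` (multiplier legs at `y = L • Y + r`);
  `GamΦ_eq_re_latticeKernel_decimate`, `Gam_eq_re_latticeKernel_decimate`; **`KInv_eq_re_latticeKernel_decimate`** (all four blocks at
  once, the `LegOn` support convention of `KInv_eq_re_latticeKernel` kept literally).
WHAT IS NOT HERE: any estimate (the symbol-difference bound «(N1-Cauchy)» is leaf-16's; (N1) itself is `FineReadoutDecay`); the unit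
factors of the normalised columns `H̃_N = N^{d+2}·wH_N` (scalars, `latticeKernel_const_mul`); the `KInvStep`∕`unitK` decimated family
(road P1's `CombesThomasFibreStep` unfolding composes with §3 verbatim when a consumer asks).
-/

noncomputable section

open Complex
open scoped Real BigOperators
open Literature.MathematicalPhysics.QuantumFieldTheory
open Literature.MathematicalPhysics.QuantumFieldTheory.Balaban1983to89
open Literature.MathematicalPhysics.QuantumFieldTheory.Balaban1983to89.Beta
open Literature.Probability.LatticeModels (TorusSite Torus.proj)
open LatticeForm (quo)
open B4Strip (ofRealVec)
open B4ContourShift (latticeKernel BZ)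
open BlochFibreMatrix (Idx)
open FibreInverseDecay (trigPolySymbol cphase cphase_periodic)
open KernelSpecInstance (wH wΦ)
open KKTFluctuationKernel (Gam GamΦ)
open OneStepResolventKernel (Fib KInv)
open Summit.QuantumFields.BalabanUV.Beta.GAN24.CombesThomasFibre (fibInv wH_eq_re_latticeKernel wΦ_eq_re_latticeKernel
  GamΦ_eq_re_latticeKernel Gam_eq_re_latticeKernel KInv_eq_re_latticeKernel legIdx LegOn)
open Summit.QuantumFields.BalabanUV.Beta.GAN24.FibreContinuity (continuous_fibInv_ofRealVec)
open Summit.QuantumFields.BalabanUV.Beta.GAN24.AliasDecimate (aliasSym latticeKernel_decimate)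

namespace Summit.QuantumFields.BalabanUV.Beta.GAN24.MinimiserColumnDecimate

variable {d : ℕ} {N : ℕ} [NeZero N]

/-! ## §1 The inverse-fibre entries are globally `2π`-periodic (continuity on the real zone: `FibreContinuity`, BY NAME) -/

/-- [folklore] A trigonometric-polynomial matrix symbol is globally `2π`-periodic in each coordinate. -/
theorem trigPolySymbol_periodic {n : Type*} (S : Finset (Fin (d + 1) → ℤ)) (L : (Fin (d + 1) → ℤ) → Matrix n n ℂ)
    (i : Fin (d + 1)) (P : Fin (d + 1) → ℂ) :
    trigPolySymbol S L (Function.update P i (P i + 2 * π)) = trigPolySymbol S L P := by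
  unfold trigPolySymbol
  exact Finset.sum_congr rfl fun a _ => by rw [cphase_periodic]

/-- [folklore] **THE INVERSE-FIBRE ENTRIES ARE GLOBALLY `2π`-PERIODIC** in each coordinate of the (complex) coarse momentum. -/
theorem fibInv_periodic (i j : Idx (d + 1) N) (μ : Fin (d + 1)) (P : Fin (d + 1) → ℂ) :
    fibInv N i j (Function.update P μ (P μ + 2 * π)) = fibInv N i j P := by
  unfold fibInv
  rw [trigPolySymbol_periodic]

/-! ## §2 Block arithmetic: the `N`-block label read through the `N·L`-blocks -/

/-- [folklore] THE BLOCK OFFSET of the `N`-block of `z` inside its `N·L`-block: `(quo N z)_i mod L ∈ {0, …, L−1}`. -/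
def boff (N L : ℕ) (z : Fin (d + 1) → ℤ) : Fin (d + 1) → ℤ := fun i => quo N z i % (L : ℤ)

/-- [folklore] `quo N z = L • quo (N·L) z + boff N L z` (nested block labels `quo (N·L) z = quo L (quo N z)` — leaf-05's
`ScaleNesting.quo_mul`, re-derived inline — plus Euclidean division by `L`). -/
theorem quo_eq_zsmul_quo_mul_add (N L : ℕ) (z : Fin (d + 1) → ℤ) :
    quo N z = (L : ℤ) • quo (N * L) z + boff N L z := by
  funext i
  have hq : quo (N * L) z i = quo L (quo N z) i := by
    simp only [quo, Nat.cast_mul]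
    exact (Int.ediv_ediv_of_nonneg (Int.natCast_nonneg N)).symm
  simp only [Pi.add_apply, Pi.smul_apply, smul_eq_mul, boff]
  rw [hq]
  simp only [quo]
  exact (Int.mul_ediv_add_emod _ _).symm

/-- [folklore] The block offset is nonnegative. -/
theorem boff_nonneg (N L : ℕ) [NeZero L] (z : Fin (d + 1) → ℤ) (i : Fin (d + 1)) : 0 ≤ boff N L z i :=
  Int.emod_nonneg _ (by exact_mod_cast NeZero.ne L)

/-- [folklore] The block offset is `< L`. -/
theorem boff_lt (N L : ℕ) [NeZero L] (z : Fin (d + 1) → ℤ) (i : Fin (d + 1)) : boff N L z i < L :=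
  Int.emod_lt_of_pos _ (by exact_mod_cast Nat.pos_of_ne_zero (NeZero.ne L))

/-! ## §3 The four blocks of `KInv N` as lattice kernels over the momentum of the coarser blocking `N·L` -/

variable (L : ℕ) [NeZero L]

/-- [folklore] **THE MINIMISER COLUMN OF BLOCKING `N` READ OVER THE MOMENTUM OF BLOCKING `N·L`**: for any decomposition
`quo N z = L • Z + r` of the block label, `wH κ l z = Re latticeKernel (aliasSym L r (fibInv N (inl (κ, proj N z)) (inr (inr l)))) Z` — the
symbol is the `L`-alias average of the inverse-fibre entry over the `L^{d+1}` level-`N` momenta above the level-`N·L` momentum. -/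
theorem wH_eq_re_latticeKernel_decimate (κ l : Fin (d + 1)) (z Z r : Fin (d + 1) → ℤ) (hz : quo N z = (L : ℤ) • Z + r) :
    wH (N := N) κ l z =
      (latticeKernel (aliasSym L r (fibInv N (Sum.inl (κ, Torus.proj N z)) (Sum.inr (Sum.inr l)))) Z).re := by
  rw [wH_eq_re_latticeKernel, hz, latticeKernel_decimate L (fibInv_periodic _ _) (continuous_fibInv_ofRealVec _ _)]

/-- [folklore] The canonical instance: `Z = quo (N·L) z`, `r = boff N L z`. -/
theorem wH_eq_re_latticeKernel_decimate' (κ l : Fin (d + 1)) (z : Fin (d + 1) → ℤ) :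
    wH (N := N) κ l z =
      (latticeKernel (aliasSym L (boff N L z) (fibInv N (Sum.inl (κ, Torus.proj N z)) (Sum.inr (Sum.inr l)))) (quo (N * L) z)).re :=
  wH_eq_re_latticeKernel_decimate L κ l z _ _ (quo_eq_zsmul_quo_mul_add N L z)

/-- [folklore] **THE MULTIPLIER RESPONSE** `wΦ κ l y` (multiplier legs at the level-`N` coarse point `y`) over the level-`N·L` momentum:
for `y = L • Y + r`, `wΦ κ l y = Re latticeKernel (aliasSym L r (fibInv N (inr (inr κ)) (inr (inr l)))) Y`. -/
theorem wΦ_eq_re_latticeKernel_decimate (κ l : Fin (d + 1)) (Y r : Fin (d + 1) → ℤ) :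
    wΦ (N := N) κ l ((L : ℤ) • Y + r) =
      (latticeKernel (aliasSym L r (fibInv N (Sum.inr (Sum.inr κ)) (Sum.inr (Sum.inr l)))) Y).re := by
  rw [wΦ_eq_re_latticeKernel, latticeKernel_decimate L (fibInv_periodic _ _) (continuous_fibInv_ofRealVec _ _)]

/-- [folklore] **THE MULTIPLIER RESPONSE TO A FORCE** `GamΦ κ q l x'` over the level-`N·L` momentum: for `q − quo N x' = L • Y + r`,
`GamΦ κ q l x' = Re latticeKernel (aliasSym L r (fibInv N (inr (inr κ)) (inl (l, proj N x')))) Y`. -/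
theorem GamΦ_eq_re_latticeKernel_decimate (κ : Fin (d + 1)) (q : Fin (d + 1) → ℤ) (l : Fin (d + 1)) (x' : Fin (d + 1) → ℤ)
    (Y r : Fin (d + 1) → ℤ) (h : q - quo N x' = (L : ℤ) • Y + r) :
    GamΦ (N := N) κ q l x' =
      (latticeKernel (aliasSym L r (fibInv N (Sum.inr (Sum.inr κ)) (Sum.inl (l, Torus.proj N x')))) Y).re := by
  rw [GamΦ_eq_re_latticeKernel, h, latticeKernel_decimate L (fibInv_periodic _ _) (continuous_fibInv_ofRealVec _ _)]

/-- [folklore] **THE FLUCTUATION COVARIANCE** `Gam κ x l x'` over the level-`N·L` momentum: for `quo N x − quo N x' = L • Y + r`,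
`Gam κ x l x' = Re latticeKernel (aliasSym L r (fibInv N (inl (κ, proj N x)) (inl (l, proj N x')))) Y`. -/
theorem Gam_eq_re_latticeKernel_decimate (κ : Fin (d + 1)) (x : Fin (d + 1) → ℤ) (l : Fin (d + 1)) (x' : Fin (d + 1) → ℤ)
    (Y r : Fin (d + 1) → ℤ) (h : quo N x - quo N x' = (L : ℤ) • Y + r) :
    Gam (N := N) κ x l x' =
      (latticeKernel (aliasSym L r (fibInv N (Sum.inl (κ, Torus.proj N x)) (Sum.inl (l, Torus.proj N x')))) Y).re := by
  rw [Gam_eq_re_latticeKernel, h, latticeKernel_decimate L (fibInv_periodic _ _) (continuous_fibInv_ofRealVec _ _)]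

/-- [folklore] **ALL FOUR BLOCKS AT ONCE**: the packed resolvent of blocking `N`, entry by entry, is the real part of a lattice kernel over
the momentum of the coarser blocking `N·L`, for any decomposition `quo N x − quo N y = L • Y + r` of the block-label displacement. -/
theorem KInv_eq_re_latticeKernel_decimate (x y : Fin (d + 1) → ℤ) (a b : Fib d) (Y r : Fin (d + 1) → ℤ)
    (h : quo N x - quo N y = (L : ℤ) • Y + r) :
    KInv (N := N) x y a b =
      if LegOn N a x ∧ LegOn N b y then
        (latticeKernel (aliasSym L r (fibInv N (legIdx N a x) (legIdx N b y))) Y).re else 0 := by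
  rw [KInv_eq_re_latticeKernel, h, latticeKernel_decimate L (fibInv_periodic _ _) (continuous_fibInv_ofRealVec _ _)]

end Summit.QuantumFields.BalabanUV.Beta.GAN24.MinimiserColumnDecimate

end
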